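import Literature.Geometry.Lorentzian.CoordBochner
import Literature.Geometry.Lorentzian.CoordCurvatureRicciIdentity
import Literature.Geometry.Lorentzian.CoordEntropyFormula
import HarnessLib

/-!
# Commuting the Laplacian with the Hessian of a function, in coordinates:
# `Δ(Hess f) − Hess(Δf) = Rm ∗ Hess f + ∇Rm ∗ df`

A further layer of the coordinate tensor calculus (`CoordCurvature`, `CoordBianchi`,
`CoordBochner`, `CoordCurvatureRicciIdentity`): metric components `G : E → (E →L E →L ℝ)`,
smooth, symmetric and nondegenerate on an open set `V` (`IsMetricOn G V`), Christoffel map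
`Γ = chrAt G`, curvature `R(X,Y) = riemAt G x X Y`, its covariant derivative
`(∇_W R)(X,Y) = covRiemAt G x W X Y`, Hessian `Hess f = hessAt G f`, Laplacian
`Δf = lapAt G f = tr_G Hess f`, covariant derivatives of fields of bilinear / trilinear forms
`cov₂At`, `cov₃At`, so that `(∇²_{X,A} Hess f)(B,C) = cov₃At G (cov₂At G (hessAt G f)) x X A B C`.
Support file for the named fact
`Literature.Geometry.Riemannian.gurskyViaclovsky_hessianEstimate_weighted_four`
(Gursky–Viaclovsky 2003, Prop. 6; Chen 2005, Thm. 1 (a)), whose proof (Chen 2005, §3) applies the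
maximum principle to `Δu + |∇u|²` and needs `F^{ij}(Δu)_{ij}` in terms of `F^{ij}(Δ∇²u)_{ij}`:
"Changing the order of the covariant differentiations … `F^{ij}u_{kkij} ≥ F^{ij}u_{ijkk} − C ΣF^{ii}(…)`".
Here that commutation is proved as an exact identity, for a `C^∞` function `f` on `V`:

* `IsMetricOn.cov₃At_cov₂At_hessAt_swap₂₃` — **the differentiated Codazzi identity**:
  `(∇²_{W,A} Hess f)(B,C) = (∇²_{W,B} Hess f)(A,C) − Hess f(W, R(A,B)C) − df((∇_W R)(A,B)C)`
  (the covariant derivative along `W` of `(∇_A Hess f)(B,C) − (∇_B Hess f)(A,C) = −df(R(A,B)C)`,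
  `IsMetricOn.cov₂At_hessAt_comm`; Topping 2006, (2.1.3) on `df`);
* `IsMetricOn.cov₃At_cov₂At_hessAt_swap₃₄` — `∇² Hess f` is symmetric in its form slots;
* `IsMetricOn.hessAt_lapAt` — **`Hess(Δf)(B,C) = Σ g^{kl} (∇²_{B,C} Hess f)(b_k,b_l)`** (the metric
  trace commutes with `∇²`, `∇g = 0`; O'Neill 1983, Ch. 3, p. 86);
* `IsMetricOn.lap_hessAt_sub_hessAt_lapAt` — **the commutator**: with
  `(Δ Hess f)(B,C) = Σ g^{kl}(∇²_{b_k,b_l} Hess f)(B,C)`,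
  `(Δ Hess f)(B,C) − Hess(Δf)(B,C) = −Σ g^{kl} [Hess f(B, R(b_k,C)b_l) + df((∇_B R)(b_k,C)b_l)
    + Hess f(b_k, R(b_l,B)C) + df((∇_{b_k} R)(b_l,B)C) + Hess f(R(b_k,B)b_l, C) + Hess f(b_l, R(b_k,B)C)]`
  — four slot moves `(X,A;B,C) → (X,B;A,C) → (B,X;A,C) → (B,X;C,A) → (B,C;X,A)`, two by the
  differentiated Codazzi identity and one by the Ricci identity for fields of bilinear forms
  (`IsMetricOn.cov₃At_cov₂At_comm`, Topping 2006, (2.1.2)–(2.1.3)), then the trace. Every term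
  on the right is bilinear in `(Hess f, df)` and `(R, ∇R)`: this is the classical
  `Δ∇²f = ∇²Δf + Rm ∗ ∇²f + ∇Ric ∗ ∇f`.

Everything is by the Fréchet calculus on constant fields of the earlier layers; everything is
proved, and no definition and no statement of `Prop` type is introduced.

## References

* P. Topping, *Lectures on the Ricci flow*, LMS Lecture Note Series 325, CUP 2006, §2.1
  ((2.1.2)–(2.1.6): commuting covariant derivatives). [Topping2006]
* B. O'Neill, *Semi-Riemannian geometry with applications to relativity*, Academic Press 1983,
  Ch. 2, Prop. 2.13; Ch. 3, Prop. 3.37, p. 86. [ONeill1983]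
* S. Chen, *Local estimates for some fully nonlinear elliptic equations*, IMRN 2005:63, §3
  (proof of Thm. 1: "Changing the order of the covariant differentiations"). [Chen2005]
* M. J. Gursky, J. A. Viaclovsky, J. Differential Geom. 63 (2003), Prop. 6. [GurskyViaclovsky2003]
-/

noncomputable section


set_option maxSynthPendingDepth 3

open Set Filter ContinuousLinearMap Module
open scoped Topology ContDiff

namespace Literature.Geometry.Lorentzian

namespace MetricCoord

variable {E : Type*} [NormedAddCommGroup E] [NormedSpace ℝ E] [CompleteSpace E]
  {G : E → E →L[ℝ] E →L[ℝ] ℝ} {V : Set E} {x : E} {f : E → ℝ}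

/-! ### The differentiated Codazzi identity and the symmetries of `∇² Hess f` -/

/-- **The differentiated Codazzi identity for the Hessian.** For `f` of class `C^∞` on `V` and
`x ∈ V`, `(∇²_{W,A} Hess f)(B,C) = (∇²_{W,B} Hess f)(A,C) − [Hess f(W, R(A,B)C) + df((∇_W R)(A,B)C)]`:
the identity of fields `(∇_A Hess f)(B,C) = (∇_B Hess f)(A,C) − df(R(A,B)C)` near `x`
(`IsMetricOn.cov₂At_hessAt_comm`, Topping 2006, (2.1.3)) differentiated covariantly along `W`
(`cov₃At` commutes with the slot permutation, `cov₃At_swap₁₂`, and the covariant derivative of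
the field `(A,B,C) ↦ df(R(A,B)C)` is `Hess f(W,R(A,B)C) + df((∇_W R)(A,B)C)`, `covRiemAt`).
[cite: Topping2006, §2.1, (2.1.3)] [cite: ONeill1983, Ch. 3, Prop. 3.37] -/
theorem IsMetricOn.cov₃At_cov₂At_hessAt_swap₂₃ (hG : IsMetricOn G V) (hx : x ∈ V)
    (hf : ContDiffOn ℝ ∞ f V) (W A B C : E) :
    cov₃At G (cov₂At G (hessAt G f)) x W A B C =
      cov₃At G (cov₂At G (hessAt G f)) x W B A C
        - (hessAt G f x W (riemAt G x A B C) + fderiv ℝ f x (covRiemAt G x W A B C)) := by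
  set τ : E → E →L[ℝ] E →L[ℝ] E →L[ℝ] ℝ := cov₂At G (hessAt G f) with hτ
  -- the field `ρ(y)(X,Y,Z) = Df_y(R_y(X,Y)Z)`
  set ρ : E → E →L[ℝ] E →L[ℝ] E →L[ℝ] ℝ := fun y ↦
    ((ContinuousLinearMap.compL ℝ E (E →L[ℝ] E) (E →L[ℝ] ℝ))
      ((ContinuousLinearMap.compL ℝ E E ℝ) (fderiv ℝ f y))).comp (riemCLM G y) with hρ
  have hρa : ∀ y X Y Z, ρ y X Y Z = fderiv ℝ f y (riemAt G y X Y Z) := by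
    intro y X Y Z
    simp only [hρ, ContinuousLinearMap.comp_apply, ContinuousLinearMap.compL_apply, riemCLM_apply]
  -- differentiability at `x`
  have hfx : ContDiffAt ℝ ∞ f x := (hf x hx).contDiffAt (hG.mem_nhds hx)
  have hDf : DifferentiableAt ℝ (fderiv ℝ f) x :=
    (hfx.fderiv_right (m := ∞) (by simp)).differentiableAt (by simp)
  have hτd : DifferentiableAt ℝ τ x := hG.differentiableAt_cov₂At hx (hG.contDiffAt_hessAt hx hf)
  have hτ'd : DifferentiableAt ℝ (fun y ↦ swap₁₂ (τ y)) x :=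
    (swap₁₂ (E := E)).differentiableAt.comp x hτd
  have hR := hG.differentiableAt_riemCLM hx
  have hφ : DifferentiableAt ℝ (fun y ↦ (ContinuousLinearMap.compL ℝ E (E →L[ℝ] E) (E →L[ℝ] ℝ))
      ((ContinuousLinearMap.compL ℝ E E ℝ) (fderiv ℝ f y))) x :=
    ((ContinuousLinearMap.compL ℝ E (E →L[ℝ] E) (E →L[ℝ] ℝ)).differentiableAt).comp x
      (((ContinuousLinearMap.compL ℝ E E ℝ).differentiableAt).comp x hDf)
  have hρd : DifferentiableAt ℝ ρ x := hφ.clm_comp hR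
  -- the Codazzi identity as an identity of fields near `x`
  have hcod : τ =ᶠ[𝓝 x] fun y ↦ swap₁₂ (τ y) - ρ y := by
    filter_upwards [hG.mem_nhds hx] with y hy
    ext X Y Z
    simp only [_root_.sub_apply, swap₁₂_apply, hρa]
    have h := hG.cov₂At_hessAt_comm hy hf X Y Z
    rw [hτ]
    linarith
  have h1 : cov₃At G τ x W A B C = cov₃At G τ x W B A C - cov₃At G ρ x W A B C := by
    have e : cov₃At G τ x W A B C = cov₃At G (fun y ↦ swap₁₂ (τ y) - ρ y) x W A B C := by
      rw [cov₃At_congr hcod]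
    rw [e, cov₃At_sub hτ'd hρd]
    simp only [_root_.sub_apply]
    rw [cov₃At_swap₁₂ hτd]
  -- the covariant derivative of `ρ`
  have h2 : cov₃At G ρ x W A B C =
      hessAt G f x W (riemAt G x A B C) + fderiv ℝ f x (covRiemAt G x W A B C) := by
    rw [cov₃At_apply]
    -- evaluation commutes with differentiation
    have hev : fderiv ℝ ρ x W A B C = fderiv ℝ (fun y ↦ ρ y A B C) x W := by
      have e1 : DifferentiableAt ℝ (fun y ↦ ρ y A) x := differentiableAt_clm_apply_const hρd A
      have e2 : DifferentiableAt ℝ (fun y ↦ ρ y A B) x := differentiableAt_clm_apply_const e1 B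
      rw [fderiv_clm_apply_const e2 C W, fderiv_clm_apply_const e1 B W, fderiv_clm_apply_const hρd A W]
    have hfun : (fun y ↦ ρ y A B C) = fun y ↦ fderiv ℝ f y (riemAt G y A B C) := by
      funext y; exact hρa y A B C
    have hv : DifferentiableAt ℝ (fun y ↦ riemAt G y A B C) x :=
      differentiableAt_clm_apply_const (hG.differentiableAt_riemAt hx A B) C
    have hprod : HasFDerivAt (fun y ↦ fderiv ℝ f y (riemAt G y A B C))
        ((fderiv ℝ f x).comp (fderiv ℝ (fun y ↦ riemAt G y A B C) x) +
          (fderiv ℝ (fderiv ℝ f) x).flip (riemAt G x A B C)) x :=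
      hDf.hasFDerivAt.clm_apply hv.hasFDerivAt
    rw [hev, hfun, hprod.fderiv]
    have hv' : fderiv ℝ (fun y ↦ riemAt G y A B C) x W = fderiv ℝ (fun y ↦ riemAt G y A B) x W C := by
      rw [fderiv_clm_apply_const (hG.differentiableAt_riemAt hx A B) C W]
    simp only [_root_.add_apply, ContinuousLinearMap.comp_apply,
      ContinuousLinearMap.flip_apply, hρa, hessAt_apply, covRiemAt_apply, map_add, map_sub, hv']
    ring
  rw [h1, h2]

/-- **`∇² Hess f` is symmetric in its two form slots**: `(∇²_{W,A} Hess f)(B,C) = (∇²_{W,A} Hess f)(C,B)`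
(the Hessian is symmetric, `IsMetricOn.hessAt_comm`, hence so are `∇ Hess f` (`cov₂At_symm`) and,
differentiating once more, `∇² Hess f`, `cov₃At_swap₂₃`). [folklore] -/
theorem IsMetricOn.cov₃At_cov₂At_hessAt_swap₃₄ (hG : IsMetricOn G V) (hx : x ∈ V)
    (hf : ContDiffOn ℝ ∞ f V) (W A B C : E) :
    cov₃At G (cov₂At G (hessAt G f)) x W A B C = cov₃At G (cov₂At G (hessAt G f)) x W A C B := by
  set τ : E → E →L[ℝ] E →L[ℝ] E →L[ℝ] ℝ := cov₂At G (hessAt G f) with hτ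
  have hτd : DifferentiableAt ℝ τ x := hG.differentiableAt_cov₂At hx (hG.contDiffAt_hessAt hx hf)
  -- `∇H` is symmetric in its form slots near `x`
  have hsym : τ =ᶠ[𝓝 x] fun y ↦ swap₂₃ (τ y) := by
    filter_upwards [hG.mem_nhds hx] with y hy
    ext X Y Z
    simp only [swap₂₃_apply]
    have hHs : ∀ᶠ z in 𝓝 y, ∀ v w, hessAt G f z v w = hessAt G f z w v := by
      filter_upwards [hG.mem_nhds hy] with z hz v w using
        hG.hessAt_comm hz (contDiffAt_of_contDiffOn hG.isOpen hf hz) v w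
    exact cov₂At_symm (hG.differentiableAt_hessAt hy hf) hHs X Y Z
  have e : cov₃At G τ x W A B C = cov₃At G (fun y ↦ swap₂₃ (τ y)) x W A B C := by
    rw [cov₃At_congr hsym]
  rw [e, cov₃At_swap₂₃ hτd]

section Trace

variable {ι : Type*} [Fintype ι] [FiniteDimensional ℝ E] (b : Basis ι ℝ E)

/-- **The Hessian of the Laplacian**: `Hess(Δf)(B,C) = Σ_{kl} g^{kl} (∇²_{B,C} Hess f)(b_k, b_l)` in
any basis `b` — the metric trace commutes with covariant differentiation (`∇g = 0`,
`IsMetricOn.fderiv_mtrAt`, O'Neill 1983, Ch. 3, p. 86), applied twice: `∂_C Δf = tr_G(∇_C Hess f)`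
and `∂_B tr_G(∇_C Hess f) = tr_G(∇²_{B,C} Hess f) + tr_G(∇_{Γ(B,C)} Hess f)`, the last term being
`∂_{Γ(B,C)} Δf`. [cite: ONeill1983, Ch. 3, p. 86] -/
theorem IsMetricOn.hessAt_lapAt (hG : IsMetricOn G V) (hx : x ∈ V) (hf : ContDiffOn ℝ ∞ f V)
    (B C : E) :
    hessAt G (lapAt G f) x B C =
      ∑ k, ∑ l, ginv G b x k l * cov₃At G (cov₂At G (hessAt G f)) x B C (b k) (b l) := by
  set τ : E → E →L[ℝ] E →L[ℝ] E →L[ℝ] ℝ := cov₂At G (hessAt G f) with hτ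
  have hτd : DifferentiableAt ℝ τ x := hG.differentiableAt_cov₂At hx (hG.contDiffAt_hessAt hx hf)
  -- `∂_C Δf = tr_G (∇_C Hess f)` near `x`
  have hD1 : ∀ y ∈ V, ∀ Z, fderiv ℝ (lapAt G f) y Z = mtrAt G y (τ y Z) := fun y hy Z ↦
    hG.fderiv_mtrAt hy (hG.differentiableAt_hessAt hy hf) Z
  have hD1' : (fun y ↦ fderiv ℝ (lapAt G f) y C) =ᶠ[𝓝 x] fun y ↦ mtrAt G y (τ y C) := by
    filter_upwards [hG.mem_nhds hx] with y hy using hD1 y hy C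
  -- the second derivative
  have hL : ContDiffAt ℝ ∞ (lapAt G f) x := (hG.contDiffOn_lapAt hf x hx).contDiffAt (hG.mem_nhds hx)
  have hDL : DifferentiableAt ℝ (fderiv ℝ (lapAt G f)) x :=
    (hL.fderiv_right (m := ∞) (by simp)).differentiableAt (by simp)
  have hτC : DifferentiableAt ℝ (fun y ↦ τ y C) x := differentiableAt_clm_apply_const hτd C
  have hD2 : fderiv ℝ (fderiv ℝ (lapAt G f)) x B C = mtrAt G x (cov₂At G (fun y ↦ τ y C) x B) := by
    rw [← fderiv_clm_apply_const hDL C B, hD1'.fderiv_eq, hG.fderiv_mtrAt hx hτC B]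
  -- `∇_B (y ↦ (∇H)_y(C;·,·)) = (∇²H)(B,C;·,·) + (∇H)(Γ(B,C);·,·)`
  have hcov : cov₂At G (fun y ↦ τ y C) x B = cov₃At G τ x B C + τ x (chrAt G x B C) := by
    ext Y Z
    rw [cov₂At_apply, _root_.add_apply, _root_.add_apply, cov₃At_apply,
      fderiv_clm_apply_const hτd C B]
    ring
  rw [hessAt_apply, hD2, hcov, mtrAt_add, mtrAt_eq_sum b, hD1 x hx (chrAt G x B C)]
  ring

/-- **The commutator of the Laplacian and the Hessian of a function** (the classical
`Δ∇²f − ∇²Δf = Rm ∗ ∇²f + ∇Ric ∗ ∇f`; Chen 2005, §3: "Changing the order of the covariant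
differentiations"; Topping 2006, (2.1.2)–(2.1.6)). For `f` of class `C^∞` on `V`, `x ∈ V` and a
basis `b`, with `(Δ Hess f)(B,C) = Σ g^{kl}(∇²_{b_k,b_l} Hess f)(B,C)`:
`(Δ Hess f)(B,C) − Hess(Δf)(B,C) = −Σ_{kl} g^{kl} [Hess f(B, R(b_k,C)b_l) + df((∇_B R)(b_k,C)b_l)
 + Hess f(b_k, R(b_l,B)C) + df((∇_{b_k} R)(b_l,B)C) + Hess f(R(b_k,B)b_l, C) + Hess f(b_l, R(b_k,B)C)]`.
Proof: for each `(X,A) = (b_k,b_l)` the four slot moves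
`(X,A;B,C) → (X,B;A,C) → (B,X;A,C) → (B,X;C,A) → (B,C;X,A)` (`cov₃At_cov₂At_hessAt_swap₂₃`,
`cov₃At_cov₂At_comm`, `cov₃At_cov₂At_hessAt_swap₃₄`, `cov₃At_cov₂At_hessAt_swap₂₃`), then
`hessAt_lapAt`. [cite: Chen2005, §3] [cite: Topping2006, §2.1, (2.1.2)–(2.1.6)] -/
theorem IsMetricOn.lap_hessAt_sub_hessAt_lapAt (hG : IsMetricOn G V) (hx : x ∈ V)
    (hf : ContDiffOn ℝ ∞ f V) (B C : E) :
    ∑ k, ∑ l, ginv G b x k l * cov₃At G (cov₂At G (hessAt G f)) x (b k) (b l) B C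
      - hessAt G (lapAt G f) x B C =
      -∑ k, ∑ l, ginv G b x k l *
        ((hessAt G f x B (riemAt G x (b k) C (b l)) + fderiv ℝ f x (covRiemAt G x B (b k) C (b l)))
          + (hessAt G f x (b k) (riemAt G x (b l) B C)
            + fderiv ℝ f x (covRiemAt G x (b k) (b l) B C))
          + hessAt G f x (riemAt G x (b k) B (b l)) C
          + hessAt G f x (b l) (riemAt G x (b k) B C)) := by
  have hH : ContDiffAt ℝ ∞ (hessAt G f) x := hG.contDiffAt_hessAt hx hf
  -- the chain of four slot moves, for each pair `(X, A) = (b k, b l)`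
  have key : ∀ X A : E, cov₃At G (cov₂At G (hessAt G f)) x X A B C
      - cov₃At G (cov₂At G (hessAt G f)) x B C X A =
      -((hessAt G f x B (riemAt G x X C A) + fderiv ℝ f x (covRiemAt G x B X C A))
        + (hessAt G f x X (riemAt G x A B C) + fderiv ℝ f x (covRiemAt G x X A B C))
        + hessAt G f x (riemAt G x X B A) C + hessAt G f x A (riemAt G x X B C)) := by
    intro X A
    have m1 := hG.cov₃At_cov₂At_hessAt_swap₂₃ hx hf X A B C      -- (X,A;B,C) → (X,B;A,C)
    have m2 := hG.cov₃At_cov₂At_comm hx hH X B A C               -- (X,B;A,C) → (B,X;A,C)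
    have m3 := hG.cov₃At_cov₂At_hessAt_swap₃₄ hx hf B X A C      -- (B,X;A,C) → (B,X;C,A)
    have m4 := hG.cov₃At_cov₂At_hessAt_swap₂₃ hx hf B X C A      -- (B,X;C,A) → (B,C;X,A)
    linarith
  rw [hG.hessAt_lapAt b hx hf B C, ← Finset.sum_sub_distrib, ← Finset.sum_neg_distrib]
  refine Finset.sum_congr rfl fun k _ ↦ ?_
  rw [← Finset.sum_sub_distrib, ← Finset.sum_neg_distrib]
  refine Finset.sum_congr rfl fun l _ ↦ ?_
  rw [← mul_sub, key (b k) (b l)]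
  ring

end Trace

end MetricCoord

end Literature.Geometry.Lorentzian

end
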